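import Summits.BirchSwinnertonDyer.Rank1Residual.Additive.PotSupersingularTprimeNotCotorsion
import Summits.BirchSwinnertonDyer.Rank1Residual.Additive.GoodModelTameThree
import Summits.BirchSwinnertonDyer.Rank1Residual.GaloisImage.QuarticKummerLevel
import HarnessLib

/-!
# Schneider's theorem (Greenberg LNM 1716 Thm. 1.7) on O5b = the census cell `(t′)` at `p = 3`, and
# on ALL of O5 at every odd `p`: `Sel_{p^∞}(E/ℚ_∞)` is NOT `Λ`-cotorsion — row T-CG-SS addendum A3,
# file A3c (cell `b2b-bsdres`, team n1011; seat n1011-p05 gen 8)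

HONEST FRAMING (cell `b2b-bsdres`, run/shared/lean/b2b/bsd-rank1-residual/, verbatim in every
file): the goal of the cell is to DELETE the COMBINATION-SHAPED residual classes of the
Birch–Swinnerton-Dyer formula for ALL analytic-rank `≤ 1` elliptic curves over `ℚ` — "full BSD
formula for every rank `≤ 1` curve in class `C`" assembled STRICTLY from published theorems — so
that the rank-`≤ 1` remainder becomes exactly the CONSTRUCTION-SHAPED classes, which are TYPED
(missing-input `Prop`s), NOT attempted. This is not "finishing BSD". Team n1011 (X4 ∧ `p = 3`,
§I N10/N11; here the O5 cell of RESIDUAL-MAP §I, mark OPEN and UNCHANGED): research route; TOOL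
theorems; no definition, no NEW named fact (inputs: the records `hCG` = T-CG's
`CoatesGreenberg1996.H1_goodModelKernel_trivial` and `hI1` = the relaxed finite-level Selmer count
`relaxedSelmer_torsion_card_growth`, carried as hypotheses and never dropped); census = EVIDENCE;
nothing booked. A NEGATIVE structural theorem — on these rows a binder `D.IsTorsion` joined to the
class column is jointly unsatisfiable mod R + (I1); it closes NO pair and is ORTHOGONAL to the o5o6
cell's anticyclotomic / Kolyvagin / Kummer-line roads at `3` (it says only that CYCLOTOMIC cotorsion
currency is void on O5).

## What

A2b proved Thm. 1.7 on `(t′)` at `p ≥ 5` and S2 on O5a = `(G) ∧ ss` at every odd `p` (S2's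
`ClassO5.not_isTorsion_of_subGss` carries NO `5 ≤ p` binder, so it covers `p = 3`). This file does
O5b = `(t′)@3` = `SubTprime W 3` (⟺ Kodaira `III / III*` at `3`, tree
`subTprime_three_iff_kodairaSymbolAt_III_or_IIIstar`; census 12 919 + 16 852 X3 ∪ X4 pairs), with
the three `p = 3` replacements of A2's inputs: the MODEL is the Kummer–Tate good model of A3a
(`SubTprime.exists_kummerGoodModel_global_three`: Tate's `III / III*` normal forms scaled by
`ι θ` / `ι(θ)³`, `θ⁴ = 3`, `c̃₄ = 0`), the LEVEL is A3b's Galois closure `Fix(ℚ(θ, i))` (index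
`∈ {4, 8}`, `exists_normal_isOpen_coprime_three_smul_eq_of_pow_four_eq_three`), and the RESIDUE is
supersingular because `j̃ = 0 = 1728` in characteristic `3`:

* §1 `eq_zero_of_zsmul_eq_zero_of_j_eq_zero_three` — every elliptic curve with `j = 0` over an
  algebraically closed field of characteristic `3` has no point of order `3` (A2a's finite-subfield
  lemma `eq_zero_of_zsmul_eq_zero_of_j_eq_of_forall_dvd_trace` with `E₁ = ofJ1728 (ZMod 3) =
  (y² = x³ + x)`, `j = 1728 = 0`, supersingular at every finite level by additive-p2's
  `SpecialJ.ringChar_dvd_trace_of_a₆_eq_zero`, `p ≠ 2 ∧ 4 ∤ p − 1`);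
  `goodReductionHom_eq_zero_of_pow_smul_eq_zero_of_residue_c₄_eq_zero_three` (every `3`-power
  torsion point of a good model with `c̃₄ = 0` reduces to `Õ`).
* §2 `localKerOver_kerSubgroup_eq_top_of_subTprime_three`, END
  **`not_isTorsion_of_subTprime_three (hCG) (hI1) (hadd : Addv W 3) (h : SubTprime W 3) (D) (hκ) (hγ) :
  ¬ D.IsTorsion`**, `ClassO5.not_isTorsion_of_subTprime_three`, and the ALL-ODD-`p` union
  **`ClassO5.not_isTorsion (hCG) (hI1) (hO : ClassO5 W p) (D) (hκ) (hγ) : ¬ D.IsTorsion`** —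
  `ClassO5 W p` = `p ≠ 2 ∧ Addv W p ∧ (SubGss W p ∨ SubTprime W p)` (cc-typer-5's
  `PotSupersingularClasses`): O5a by S2 at every odd `p`; `(t′)` by A2b at `p ≥ 5` and by this file at
  `p = 3`.

Binder honesty: `hCG`, `hI1` carried verbatim (PUBLISHED records, not discharged); class columns
`ClassO5`, `SubTprime`, `Addv`. NOT claimed: O6 (wild `3`, `SubW`: `3 ∣ e`, no prime-to-`3` fixing
level exists), `p = 2`. O5 stays OPEN; nothing booked; no O5 node / tag / TARGETS line touched.

References: R. Greenberg, LNM 1716 (1999) Thm. 1.7 p. 61, §2 pp. 83–84 [GreenbergLNM1716];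
J. Coates, R. Greenberg, Invent. Math. 124 (1996) Cor. 3.2 [CoatesGreenberg1996]; P. Schneider,
J. Indian Math. Soc. 52 (1987) §6; J. H. Silverman, *AEC* V.3.1(a), V.4.1, Ex. V.4.5, VII.2.1
[SilvermanAEC2009]; cells/n1011/skel/T-CG-SS-A3.md (4ee65abe034abfbf).
-/

noncomputable section

open scoped Classical NNReal

open Polynomial WeierstrassCurve

universe u

namespace Summit.BirchSwinnertonDyer.Rank1Residual.Additive.GoodModelLine

open NumberField IsDedekindDomain Field IsDedekindDomain.HeightOneSpectrum
  Literature.NumberTheory.GaloisRepresentations Literature.NumberTheory.EllipticCurves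
  Literature.NumberTheory.EllipticCurves.GreenbergSelmer
  Literature.NumberTheory.EllipticCurves.CoatesGreenberg1996
  Literature.NumberTheory.EllipticCurves.Rank1Residual
  Literature.NumberTheory.EllipticCurves.Rank1Residual.Typed
  Summit.BirchSwinnertonDyer.Rank1Residual.X2.GreenbergVatsalReductionDatum
  Summit.BirchSwinnertonDyer.Rank1Residual.X2.GreenbergVatsalSelmerLink
  Summit.BirchSwinnertonDyer.Rank1Residual.GaloisImage

/-! ## §1 `j = 0` is SUPERSINGULAR in characteristic `3`: no point of order `3` -/

section CharThree

/-- **`j = 0`, characteristic `3`: no point of order `3` over `k̄`.** Mathlib's `ofJ1728 = (y² = x³ + x)`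
over `𝔽₃` has `j = 1728 = 0` and is supersingular at every finite level (additive-p2's
`SpecialJ.ringChar_dvd_trace_of_a₆_eq_zero`: `p ≠ 2`, `4 ∤ p − 1`, short normal form with `a₆ = 0`),
so A2a's finite-subfield transfer `eq_zero_of_zsmul_eq_zero_of_j_eq_of_forall_dvd_trace` applies
(Silverman *AEC* V.4.1(c), Ex. V.4.5; V.3.1(a)). [cite: SilvermanAEC2009, Thm. V.3.1(a) and Exercise V.4.5] -/
theorem eq_zero_of_zsmul_eq_zero_of_j_eq_zero_three {k : Type u} [Field k] [IsAlgClosed k] [CharP k 3]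
    (V : WeierstrassCurve k) [V.IsElliptic] (hj : V.j = 0)
    (Q : V.toAffine.Point) (hQ : ((3 : ℕ) : ℤ) • Q = 0) : Q = 0 := by
  haveI : Fact (IsUnit (2 : ZMod 3)) := ⟨⟨⟨2, 2, by decide, by decide⟩, rfl⟩⟩
  haveI : Fact (Nat.Prime 3) := ⟨Nat.prime_three⟩
  letI : Algebra (ZMod 3) k := ZMod.algebra k 3
  have h1728 : (1728 : k) = 0 := by
    have h := (CharP.cast_eq_zero_iff k 3 1728).mpr (by norm_num)
    exact_mod_cast h
  refine eq_zero_of_zsmul_eq_zero_of_j_eq_of_forall_dvd_trace 3 (ofJ1728 (ZMod 3))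
    (fun K₀ _ ↦ ?_) V (by rw [hj, ofJ1728_j, map_ofNat, h1728]) Q hQ
  haveI : CharP K₀ 3 := (Algebra.charP_iff (ZMod 3) K₀ 3).mp inferInstance
  haveI := Fintype.ofFinite K₀
  haveI : ((ofJ1728 (ZMod 3)).baseChange K₀).IsShortNF := by
    refine ⟨?_, ?_, ?_⟩ <;> simp [baseChange, ofJ1728]
  rw [Nat.card_eq_fintype_card]
  exact SpecialJ.ringChar_dvd_trace_of_a₆_eq_zero ((ofJ1728 (ZMod 3)).baseChange K₀)
    (ringChar.eq_iff.mpr inferInstance) (by decide) (by simp [baseChange, ofJ1728]) (by decide)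

variable {L : Type u} [Field L] {Γ₀ : Type*} [LinearOrderedCommGroupWithZero Γ₀] {v : Valuation L Γ₀}
  {O : Type*} [CommRing O] [IsLocalRing O] [Algebra O L] (hv : v.Integers O)
  {M : WeierstrassCurve O} (hΔ : IsUnit M.Δ)

/-- **A good model with `j̃ = 0` in residue characteristic `3`: every `3`-power torsion point of
`M(L)` reduces to `Õ`** (the reduced curve is SUPERSINGULAR; §1 and A2a's
`goodReductionHom_eq_zero_of_pow_smul_eq_zero_of_forall_map`). Kodaira `III / III*` at a tame `3`
(the cell `(t′)@3`). [cite: SilvermanAEC2009, Thm. V.3.1(a), Exercise V.4.5, Prop. VII.2.1]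
[cite: GreenbergLNM1716, Thm 1.7 (p. 61) and §2 p. 83] -/
theorem goodReductionHom_eq_zero_of_pow_smul_eq_zero_of_residue_c₄_eq_zero_three
    [CharP (IsLocalRing.ResidueField O) 3] (hc₄ : IsLocalRing.residue O M.c₄ = 0)
    (P : (M.baseChange L).toAffine.Point) {n : ℕ} (hP : 3 ^ n • P = 0) :
    goodReductionHom M hv hΔ P = 0 := by
  haveI : Fact (Nat.Prime 3) := ⟨Nat.prime_three⟩
  haveI := isElliptic_map_residue (W := M) hΔ
  haveI : CharP (AlgebraicClosure (IsLocalRing.ResidueField O)) 3 :=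
    (Algebra.charP_iff (IsLocalRing.ResidueField O) (AlgebraicClosure (IsLocalRing.ResidueField O)) 3).mp
      inferInstance
  have hj0 : (M.map (IsLocalRing.residue O)).j = 0 :=
    (M.map (IsLocalRing.residue O)).j_eq_zero (by rw [map_c₄, hc₄])
  have hj : ((M.map (IsLocalRing.residue O)).map (algebraMap (IsLocalRing.ResidueField O)
      (AlgebraicClosure (IsLocalRing.ResidueField O)))).j = 0 := by
    rw [map_j, hj0, map_zero]
  exact goodReductionHom_eq_zero_of_pow_smul_eq_zero_of_forall_map hv hΔ 3
    (fun Q hQ ↦ eq_zero_of_zsmul_eq_zero_of_j_eq_zero_three _ hj Q hQ) P hP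

end CharThree

/-! ## §2 Schneider's theorem (Greenberg Thm. 1.7) on `(t′)` at `3` — and on all of O5 -/

section Three

variable (W : WeierstrassCurve ℚ) [W.IsElliptic] [W.IsGloballyMinimal]

/-- **No local condition at `3` over `ℚ_∞` on the cell `(t′)` of O5 at `p = 3`** (mod the
Coates–Greenberg record): for `E/ℚ` additive at `3` with `SubTprime W 3` (Kodaira `III / III*`),
`W.localKerOver 3 (ker κ) ℚ_v = ⊤` for the cyclotomic `κ`: over the layer `ℚ_∞ · ℚ(θ, i)` (`θ⁴ = 3`;
A3b's normal level of index `∈ {4, 8}`, prime to `3`, whose local elements fix `ι θ`, hence the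
Kummer–Tate model's `C`, A3a) the Kummer condition at `v` is vacuous by S1's
`localKerOver_eq_top_of_torsion_mem_kernel_of_level` (all `3`-power torsion of `W₀(K̄_v)` reduces to
`Õ`, §1), and S1's prime-to-`3` descent brings it down. Greenberg, LNM 1716 p. 84.
[cite: GreenbergLNM1716, §2 pp. 83–84] [cite: CoatesGreenberg1996, Cor. 3.2 (through GreenbergLNM1716)] -/
theorem localKerOver_kerSubgroup_eq_top_of_subTprime_three [Fact (Nat.Prime 3)]
    (hCG : H1_goodModelKernel_trivial.{0}) (hadd : Addv W 3) (h : SubTprime W 3)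
    (κ : ZpExtension ℚ 3) (hκ : κ.IsCyclotomic) {v : HeightOneSpectrum (𝓞 ℚ)}
    (hpv : ((3 : ℕ) : 𝓞 ℚ) ∈ v.asIdeal) :
    W.localKerOver 3 κ.kerSubgroup (v.adicCompletion ℚ) = ⊤ := by
  obtain ⟨θ, C, W₀, hW₀, hΔ, hθ, hfix, hc₄⟩ :=
    SubTprime.exists_kummerGoodModel_global_three W hadd h hpv
  haveI : CharP (IsLocalRing.ResidueField (specVal v).integer) 3 := charP_residueField_specVal 3 hpv
  -- all `3`-power torsion of `W₀(K̄_v)` reduces to `Õ`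
  have htors : ∀ P : localPoints W (v.adicCompletion ℚ), (∃ k : ℕ, 3 ^ k • P = 0) →
      Affine.Point.congrEquiv hW₀ (VariableChange.pointEquiv _ C
        (Affine.Point.congrEquiv (baseChange_baseChange_adicCompletion W v).symm P)) ∈
        kernelOfReduction W₀ (Valuation.integer.integers (specVal v)) := by
    rintro P ⟨k, hk⟩
    have hk0 : 3 ^ k •
        (show (W.baseChange (AlgebraicClosure (v.adicCompletion ℚ))).toAffine.Point from P) = 0 := hk
    refine (mem_kernelOfReduction_iff _).mpr ((goodReductionHom_eq_zero_iff _ hΔ _).mp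
      (goodReductionHom_eq_zero_of_pow_smul_eq_zero_of_residue_c₄_eq_zero_three
        (Valuation.integer.integers (specVal v)) hΔ hc₄ _ (n := k) ?_))
    rw [← map_nsmul, ← map_nsmul, ← map_nsmul, hk0, map_zero, map_zero, map_zero]
  -- the prime-to-`3` normal level fixing `θ` (the Galois closure `ℚ(θ, i)`)
  have hθ4 : θ ^ 4 = 3 := by rw [hθ]; norm_num
  obtain ⟨U, hUn, hUo, hUi, hUθ⟩ := exists_normal_isOpen_coprime_three_smul_eq_of_pow_four_eq_three hθ4
  haveI := hUn
  exact localKerOver_kerSubgroup_eq_top_of_torsion_mem_kernel W 3 (specVal_spec v) hW₀ hΔ htors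
    hCG κ hκ hpv U hUo hUi (fun σ hσ ↦ hfix σ
      (smul_absClosureEmbedding_eq_of_absGaloisRestrict_mem ℚ (v.adicCompletion ℚ) hUθ σ hσ))

/-- **Schneider's theorem (Greenberg Thm. 1.7) on O5b = `(t′)@3`: `X(E/ℚ_∞)` is NOT `Λ`-torsion** —
mod the Coates–Greenberg record (`hCG`) and the relaxed finite-level Selmer count (I1) (`hI1`). For
`E/ℚ` additive at `3` with `SubTprime W 3` (`¬ PotMult`, `f₃ = 2`, `e = 4 ∤ 2`: Kodaira `III / III*`,
potentially good SUPERSINGULAR over the tame quartic field), the cyclotomic `κ` with topological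
generator `γ`, and ANY Pontryagin-dual datum `D` of `Sel_{3^∞}(E/ℚ_∞)`: `¬ D.IsTorsion`. A NEGATIVE
STRUCTURAL theorem about the binder `D.IsTorsion` (LNM 1716 Thm. 1.7, "due to P. Schneider", with
`r(E, ℚ) = 1`), NOT about `BSD₃` of any pair; orthogonal to the o5o6 cell's anticyclotomic roads.
O5 stays OPEN; nothing booked. [cite: GreenbergLNM1716, Thm 1.7 (p. 61) and §2 p. 84]
[cite: CoatesGreenberg1996, Cor. 3.2 (through GreenbergLNM1716)] -/
theorem not_isTorsion_of_subTprime_three [Fact (Nat.Prime 3)] (hCG : H1_goodModelKernel_trivial.{0})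
    (hI1 : relaxedSelmer_torsion_card_growth.{0}) (hadd : Addv W 3) (h : SubTprime W 3)
    {κ : ZpExtension ℚ 3} {γ : absoluteGaloisGroup ℚ} (D : SelmerDualData W κ γ)
    (hκ : κ.IsCyclotomic) (hγ : κ.IsTopGenerator γ) : ¬ D.IsTorsion := by
  obtain ⟨v, hpv⟩ : ∃ v : HeightOneSpectrum (𝓞 ℚ), ((3 : ℕ) : 𝓞 ℚ) ∈ v.asIdeal :=
    ⟨(Rat.HeightOneSpectrum.primesEquiv (R := 𝓞 ℚ)).symm ⟨3, Nat.prime_three⟩,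
      (natCast_mem_asIdeal_iff_eq_primesEquiv_symm _ Nat.prime_three).2 rfl⟩
  have hv := localKerOver_kerSubgroup_eq_top_of_subTprime_three W hCG hadd h κ hκ hpv
  obtain ⟨c, hc⟩ := hI1 ℚ W 3 κ v hpv
  refine D.not_isTorsion_of_localKerOver_eq_top_of_le_card_relaxed_torsion hκ hγ v hv
    (fun n ↦ 3 ^ n) c (fun B ↦ ?_) hc
  exact ⟨B, Nat.lt_pow_self (by norm_num)⟩

/-- **Class form on `ClassO5 W 3 ∧ SubTprime W 3`** (cc-typer-5's predicates; census of record O5b: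
`III` 12 919 and `III*` 16 852 X3 ∪ X4 pairs, swapped by the `χ₋₃`-twist) — `Sel_{3^∞}(E/ℚ_∞)^∨` is
not `Λ`-torsion, mod `hCG`, `hI1`. Negative structural theorem; closes no pair; O5 stays OPEN.
[cite: GreenbergLNM1716, Thm 1.7 (p. 61)] -/
theorem ClassO5.not_isTorsion_of_subTprime_three [Fact (Nat.Prime 3)]
    (hCG : H1_goodModelKernel_trivial.{0}) (hI1 : relaxedSelmer_torsion_card_growth.{0})
    (hO : ClassO5 W 3) (h : SubTprime W 3) {κ : ZpExtension ℚ 3} {γ : absoluteGaloisGroup ℚ}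
    (D : SelmerDualData W κ γ) (hκ : κ.IsCyclotomic) (hγ : κ.IsTopGenerator γ) : ¬ D.IsTorsion :=
  GoodModelLine.not_isTorsion_of_subTprime_three W hCG hI1 hO.2.1 h D hκ hγ

variable (p : ℕ) [hp : Fact p.Prime]

/-- **Greenberg's Thm. 1.7 (Schneider) on ALL of O5, at EVERY odd prime**: for `ClassO5 W p` =
`p ≠ 2 ∧ Addv W p ∧ (SubGss W p ∨ SubTprime W p)` (cc-typer-5's `Additive/PotSupersingularClasses`,
the class split of record, O5 = O5a ⊔ `(t′)`), mod `hCG`, `hI1`: `¬ D.IsTorsion` for every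
Pontryagin-dual datum of `Sel_{p^∞}(E/ℚ_∞)`. O5a by S2's `ClassO5.not_isTorsion_of_subGss` — which
carries NO `5 ≤ p` binder, so it covers `p = 3` —, `(t′)` at `p ≥ 5` by A2b's
`ClassO5.not_isTorsion_of_subTprime`, `(t′)` at `p = 3` by `ClassO5.not_isTorsion_of_subTprime_three`.
On these rows every route positing `D.IsTorsion` (cyclotomic main-conjecture / control currency) has
a jointly unsatisfiable binder set — the O5 typing's standing remark made kernel-checkable on the
whole class. O6 (wild `3`) is NOT claimed. O5 stays OPEN; nothing booked.
[cite: GreenbergLNM1716, Thm 1.7 (p. 61) and §2 p. 84] -/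
theorem ClassO5.not_isTorsion (hCG : H1_goodModelKernel_trivial.{0})
    (hI1 : relaxedSelmer_torsion_card_growth.{0}) (hO : ClassO5 W p)
    {κ : ZpExtension ℚ p} {γ : absoluteGaloisGroup ℚ} (D : SelmerDualData W κ γ)
    (hκ : κ.IsCyclotomic) (hγ : κ.IsTopGenerator γ) : ¬ D.IsTorsion := by
  rcases hO.2.2 with h | h
  · exact ClassO5.not_isTorsion_of_subGss W p hCG hI1 hO h D hκ hγ
  · by_cases hp5 : 5 ≤ p
    · exact ClassO5.not_isTorsion_of_subTprime W p hCG hI1 hO h hp5 D hκ hγ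
    · -- the odd prime `p < 5` is `3`
      have hp3 : p = 3 := by
        have h2 := hp.out.two_le
        have hlt : p < 5 := not_le.mp hp5
        interval_cases p
        · exact absurd rfl hO.1
        · rfl
        · exact absurd hp.out (by decide)
      subst hp3
      exact ClassO5.not_isTorsion_of_subTprime_three W hCG hI1 hO h D hκ hγ

end Three

end Summit.BirchSwinnertonDyer.Rank1Residual.Additive.GoodModelLine

end
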